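import Summits.NavierStokesRegularity.NavierStokesRegularity.Theorems.StableStrataDoorAxiStability

/-!
# StableStrataDoorUniform — S26 «StableStrataDoor» (ε-STABLE STRATA: the open-neighbourhood principle K-stab(Φ,𝔖) and the
ε-AXISYMMETRIC Type-I door, uniform in the axis), part 6/6: uniformity in the axis: one ε(ν, M, U) for every axis (§11)

§11 conjugation covariance (`conjField`, `reflAxis`, `profileWindowField_conjField`, `axiDefect_conjField`,
`hasSmallAxiDefectOn_conjField`, `isClassical_conjField` via the tree's `IsClassicalNSSolutionOn.conj_linearIsometryEquiv`,
`hasTypeIDecay_conjField`), the residue uniform in the axis `AxiResidueUniform` with `axiResidueUniform_of_refl` /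
**`axiResidueUniform_holds`** (K-axi UNIFORM), and the door T-axi UNIFORM IN THE AXIS `TargetEpsAxisymUniform` PROVED
(`targetEpsAxisymUniform_holds`): `ε = ε(ν, M, U)` only, for ALL axes through the blow-up point.

Door family of LADDER-NS N0 (local Type-I window doors S20–S26); THEOREMS-ONLY landing of the nsreg-p1 design
`run/shared/lean/pub/ns-regularity-ideate/ns-regularity-ideate-p1/r25/Sketch26.lean` (ROUND-25.md; sha16 bf87a99673b3e6ef,
farm rc 0 / 0 sorry), split by section into `StableStrataDoor{Defs, WindowLimit, AxiStability, Schema, Instances, Uniform}`,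
texts verbatim, namespace = file stem.  No route, no items (DIRECTOR-NS standing #32 (2); landing lane ns-door-S23-p1).
WHAT THIS IS NOT: not NS regularity (Clay (A)) and not a dent in `NoTypeII` (stmt-0056) — every statement lives INSIDE the
Type-I class; not the swirl hard cores (no Type-I-free statement); not the Type-I Liouville conjecture — only window-open
neighbourhoods of strata where it is already a theorem; `ε` comes from compactness and is NOT explicit.
-/

noncomputable section

set_option linter.dupNamespace false

namespace Summit.NavierStokesRegularity.NavierStokesRegularity.Theorems.StableStrataDoorUniform

open MeasureTheory Set Function Filter Topology TopologicalSpace Metric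
open scoped RealInnerProductSpace NNReal ENNReal Topology Pointwise
open Literature.Analysis Literature.Analysis.FluidPDE
open Summit.NavierStokesRegularity.NavierStokesRegularity.Theorems.PoloidalWindowDoorPoloidalWindowRigidityWindow
open Summit.NavierStokesRegularity.NavierStokesRegularity.Theorems.ZoomReturnDoorDefs
open Summit.NavierStokesRegularity.NavierStokesRegularity.Theorems.ZoomReturnDoorWindowLimit
open Summit.NavierStokesRegularity.NavierStokesRegularity.Theorems.ZoomReturnDoorRemovableFactors
open Summit.NavierStokesRegularity.NavierStokesRegularity.Theorems.ZoomReturnDoorGlue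
open Summit.NavierStokesRegularity.NavierStokesRegularity.Theorems.ZoomReturnDoorExtraction
open Summit.NavierStokesRegularity.NavierStokesRegularity.Theorems.ZoomReturnDoorClassicalLimit
open Summit.NavierStokesRegularity.NavierStokesRegularity.Theorems.StableStrataDoorDefs
open Summit.NavierStokesRegularity.NavierStokesRegularity.Theorems.StableStrataDoorWindowLimit
open Summit.NavierStokesRegularity.NavierStokesRegularity.Theorems.StableStrataDoorAxiStability

/-! ## §11 UNIFORMITY IN THE AXIS: one `ε(ν, M, U)` serves EVERY axis direction (rotation covariance of the residue
frame: classical solutions, Type-I decay and the defect are conjugation-covariant; PROVED). -/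

section Uniform

/-- conjugation of a space–time field by the axis isometry: `ũ(t, x) = A⁻¹ u(t, A x)`. -/
def conjField (A : EuclideanSpace ℝ (Fin 3) ≃ₗᵢ[ℝ] EuclideanSpace ℝ (Fin 3))
    (u : ℝ → EuclideanSpace ℝ (Fin 3) → EuclideanSpace ℝ (Fin 3)) : ℝ → EuclideanSpace ℝ (Fin 3) → EuclideanSpace ℝ (Fin 3) :=
  fun t x => A.symm (u t (A x))

/-- the identity isometry (the reference axis `e₃`). -/
abbrev reflAxis : EuclideanSpace ℝ (Fin 3) ≃ₗᵢ[ℝ] EuclideanSpace ℝ (Fin 3) :=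
  LinearIsometryEquiv.refl ℝ (EuclideanSpace ℝ (Fin 3))

/-- the profile window field of the conjugated field is the conjugate of the profile window field. -/
theorem profileWindowField_conjField (ν : ℝ) (A : EuclideanSpace ℝ (Fin 3) ≃ₗᵢ[ℝ] EuclideanSpace ℝ (Fin 3))
    (u : ℝ → EuclideanSpace ℝ (Fin 3) → EuclideanSpace ℝ (Fin 3)) (s : ℝ) (ζ : EuclideanSpace ℝ (Fin 3)) :
    profileWindowField ν (conjField A u) s ζ = A.symm (profileWindowField ν u s (A ζ)) := by
  simp only [profileWindowField, conjField, LinearIsometryEquiv.map_smul]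

/-- the defect about `A e₃` of `u` is the defect about `e₃` of the conjugated field. -/
theorem axiDefect_conjField (ν : ℝ) (A : EuclideanSpace ℝ (Fin 3) ≃ₗᵢ[ℝ] EuclideanSpace ℝ (Fin 3))
    (u : ℝ → EuclideanSpace ℝ (Fin 3) → EuclideanSpace ℝ (Fin 3)) (s θ : ℝ) (ζ : EuclideanSpace ℝ (Fin 3)) :
    axiDefect A (profileWindowField ν u s) θ ζ = axiDefect reflAxis (profileWindowField ν (conjField A u) s) θ ζ := by
  simp only [axiDefect, profileWindowField_conjField]
  rfl

/-- an `ε`-small defect about `A e₃` is an `ε`-small defect about `e₃` for the conjugated field. -/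
theorem hasSmallAxiDefectOn_conjField {ν ε : ℝ} {A : EuclideanSpace ℝ (Fin 3) ≃ₗᵢ[ℝ] EuclideanSpace ℝ (Fin 3)}
    {U : Set (EuclideanSpace ℝ (Fin 3))} {u : ℝ → EuclideanSpace ℝ (Fin 3) → EuclideanSpace ℝ (Fin 3)}
    (h : HasSmallAxiDefectOn ν A ε U u) : HasSmallAxiDefectOn ν reflAxis ε U (conjField A u) := by
  intro s hs θ
  have h1 := h s hs θ
  simp only [axiDefect_conjField ν A u] at h1
  exact h1

/-- classical solutions on `(−∞,0) × ℝ³` (zero force, `ν = 1`) are covariant under conjugation by the axis isometry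
(tree `IsClassicalNSSolutionOn.conj_linearIsometryEquiv`, Majda–Bertozzi Prop. 1.1(iii)). -/
theorem isClassical_conjField {A : EuclideanSpace ℝ (Fin 3) ≃ₗᵢ[ℝ] EuclideanSpace ℝ (Fin 3)}
    {u : ℝ → EuclideanSpace ℝ (Fin 3) → EuclideanSpace ℝ (Fin 3)} {p : ℝ → EuclideanSpace ℝ (Fin 3) → ℝ}
    (hcl : IsClassicalNSSolutionOn (Set.Iio 0) 1 0 u p) :
    IsClassicalNSSolutionOn (Set.Iio 0) 1 0 (conjField A u) (fun t x => p t (A x)) := by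
  have h1 := hcl.conj_linearIsometryEquiv A.symm (uniqueDiffOn_Iio 0)
  have h2 := h1.congr_force (g := 0) (fun t _ x => by simp)
  show IsClassicalNSSolutionOn (Set.Iio 0) 1 0 (fun t x => A.symm (u t (A x))) (fun t x => p t (A x))
  simpa only [LinearIsometryEquiv.symm_symm] using h2

/-- Type-I decay is invariant under conjugation by a linear isometry. -/
theorem hasTypeIDecay_conjField {D : ℝ} {A : EuclideanSpace ℝ (Fin 3) ≃ₗᵢ[ℝ] EuclideanSpace ℝ (Fin 3)}
    {u : ℝ → EuclideanSpace ℝ (Fin 3) → EuclideanSpace ℝ (Fin 3)} (h : HasTypeIDecay D u) :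
    HasTypeIDecay D (conjField A u) := by
  intro t ht x
  have h1 := h t ht (A x)
  simpa only [conjField, LinearIsometryEquiv.norm_map] using h1

/-- R-axi UNIFORM IN THE AXIS: one `ε(ν, D, U)` for all axes. -/
def AxiResidueUniform (ν D : ℝ) : Prop :=
  ∀ (U : Set (EuclideanSpace ℝ (Fin 3))), IsOpen U → U.Nonempty → Bornology.IsBounded U →
    ∃ ε : ℝ, 0 < ε ∧ ∀ (A : EuclideanSpace ℝ (Fin 3) ≃ₗᵢ[ℝ] EuclideanSpace ℝ (Fin 3))
      (u : ℝ → EuclideanSpace ℝ (Fin 3) → EuclideanSpace ℝ (Fin 3)) (p : ℝ → EuclideanSpace ℝ (Fin 3) → ℝ),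
      IsClassicalNSSolutionOn (Set.Iio 0) 1 0 u p → HasTypeIDecay D u → HasSmallAxiDefectOn ν A ε U u →
      ∀ t < 0, ∀ x, u t x = 0

/-- the residue about the reference axis transports to every axis with the SAME `ε`. -/
theorem axiResidueUniform_of_refl {ν D : ℝ} (h : AxiResidue ν D reflAxis) : AxiResidueUniform ν D := by
  intro U hU hne hbdd
  obtain ⟨ε, hε, hres⟩ := h U hU hne hbdd
  refine ⟨ε, hε, fun A u p hcl hdec hsm t ht x => ?_⟩
  have h0 := hres (conjField A u) _ (isClassical_conjField hcl) (hasTypeIDecay_conjField hdec)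
    (hasSmallAxiDefectOn_conjField hsm) t ht (A.symm x)
  have h1 := congrArg A h0
  simpa only [conjField, LinearIsometryEquiv.apply_symm_apply, map_zero] using h1

/-- **K-axi UNIFORM: `ε`-stability of the axisymmetric Type-I Liouville theorem with one `ε(ν, D, U)` for all axes.** -/
theorem axiResidueUniform_holds {ν D : ℝ} (hν : 0 < ν) (hD : 0 < D) : AxiResidueUniform ν D :=
  axiResidueUniform_of_refl (axiStability_holds ν D reflAxis hν hD)

/-- target (rank 0) · DOOR T-axi UNIFORM IN THE AXIS: `ε = ε(ν, M, U)` only — «the scale-normalised velocity of a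
Type-I (M) blow-up stays, on every window `U`, `ε(ν,M,U)`-far in worst-angle `L¹(U)` equivariance defect from
axisymmetry about EVERY axis through the blow-up point, at times arbitrarily close to `T`». -/
def TargetEpsAxisymUniform : Prop :=
  ∀ (ν M : ℝ), 0 < ν → ∀ (U : Set (EuclideanSpace ℝ (Fin 3))), IsOpen U → U.Nonempty → Bornology.IsBounded U →
    ∃ ε : ℝ, 0 < ε ∧ ∀ (A : EuclideanSpace ℝ (Fin 3) ≃ₗᵢ[ℝ] EuclideanSpace ℝ (Fin 3)) (T : ℝ), 0 < T →
      ∀ (u : ℝ → EuclideanSpace ℝ (Fin 3) → EuclideanSpace ℝ (Fin 3)) (p : ℝ → EuclideanSpace ℝ (Fin 3) → ℝ),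
      IsClassicalNSSolutionOn (Set.Ico 0 T) ν 0 u p → IsLerayHopfOn T ν 0 (u 0) u → HasRapidSpatialDecay (u 0) →
      ∀ (x₀ : EuclideanSpace ℝ (Fin 3)) (ρ : ℝ), 0 < ρ →
      (∀ t ∈ Set.Ico 0 T, T - ρ ^ 2 < t → ∀ x ∈ Metric.ball x₀ ρ, ‖u t x‖ * (‖x - x₀‖ + Real.sqrt (ν * (T - t))) ≤ M) →
      AxiDefectEventuallySmall T x₀ u A U ε → IsBackwardBoundedAt u T x₀

/-- **DOOR T-axi, UNIFORM IN THE AXIS, HOLDS.** -/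
theorem targetEpsAxisymUniform_holds : TargetEpsAxisymUniform := by
  intro ν M hν U hU hne hbdd
  rcases le_or_gt (M / ν) 0 with hD | hD
  · refine ⟨1, one_pos, fun A T hT u p hcl hLH hdec x₀ ρ hρ hM _ => ?_⟩
    by_contra hnot
    obtain ⟨C, v, _, hdecay, hsing, _⟩ := localPointZoomAxiDefect_holds ν T hν hT u p hcl hLH hdec x₀ ρ M hρ hM hnot
    exact not_isBackwardSingularPoint_of_eq_zero (eq_zero_of_decay_nonpos hD hdecay) hsing
  · obtain ⟨ε, hε, hres⟩ := axiResidueUniform_holds hν hD U hU hne hbdd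
    refine ⟨ε, hε, fun A T hT u p hcl hLH hdec x₀ ρ hρ hM hsmall => ?_⟩
    by_contra hnot
    obtain ⟨C, v, hcls, hdecay, hsing, hax⟩ := localPointZoomAxiDefect_holds ν T hν hT u p hcl hLH hdec x₀ ρ M hρ hM hnot
    obtain ⟨hrate, hcont, hmild, hdiv⟩ := hcls
    have hmildcls : IsTypeIAncientMild C v := isTypeIAncientMild_of_class hrate hcont hmild hdiv
    obtain ⟨q, hclv⟩ :=
      Summit.NavierStokesRegularity.NavierStokesRegularity.Theorems.exists_isClassicalNSSolutionOn_Iio_of_isTypeIAncientMild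
        hmildcls
    exact not_isBackwardSingularPoint_of_eq_zero (hres A v q hclv hdecay (hax A U ε hsmall)) hsing

end Uniform

end Summit.NavierStokesRegularity.NavierStokesRegularity.Theorems.StableStrataDoorUniform
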